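import Summits.QuantumFields.BalabanUV.T4Continuum.Support.VariationalVectorEndMonotone
import Summits.QuantumFields.BalabanUV.T4Continuum.Support.VariationalAssemblySliceMinFlat
import Summits.QuantumFields.BalabanUV.T4Continuum.Support.VariationalVectorGaugeSliceUB
import Summits.QuantumFields.BalabanUV.T4Continuum.Support.VariationalVectorRegularityFlat

/-!
# T⁴ programme, spine node NE2 (U1a), lane P2 — THE MONOTONE END IS INHABITED: its four displayed leaves at flat data (`U = 1`) are kernel theorems,
# so `effV_tendsto_of_upper_geom` yields the flat tower limit WITHOUT the slice law and WITHOUT the Federbush step (K-test of (M2); cell `pub-balaban`)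

NE2 formalisation swarm `b2b-balaban-t4-ne2-formalise-*`, leaf prover 10 GEN 3 (`prover-b2b-balaban-t4-ne2-formalise-leaf-10-g3-0`, V-END holder lineage); the kernel
non-vacuity certificate of (M2) `VariationalVectorEndMonotone` (p226720), announced as the K-test in its LANDED line (CLAIMS.log 2026-08-20 16:38Z).  Pure composition BY
NAME: coarse V-UB `hUBc_tower` (leaf-09-g7 p223319), coarse V-P `hPc_tower` + structure `hGm_flat` ∕ `hG_flat` ∕ `hTcomp_flat` ∕ `hRtr_flat` ∕ `hGtr_flat` (leaf-09-g7 p222627),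
(ONE-min) `hONEm_tower` (leaf-01-g7 p225221), V-REG `hREG_flat_closed` (leaf-03-g5 p224569); the ε-decay `eps1_flat_le` from `VariationalVectorEndFlatMin` is re-derived in
one line here to keep the imports minimal.
 * **`effV_flat_tendsto_of_upper`** — for `1 ≤ d`, `2 ≤ L`, `0 < a`: `∃ X∞, Tendsto (k ↦ effV (L^k) M 1 (Gmk L M k) (QmL (L^k) M 1) a) atTop (𝓝 X∞)` (+ Hermitian, nonneg form,
   convergence of the block-spin values) — obtained from the UPPER bracket alone.  Of course `VariationalVectorEndFlatMin.effV_flat_limit` (p226153) says more (rate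
   `L^{−2k}`); the point here is only that (M2)'s socket list is jointly inhabited by landed theorems, i.e. the monotone END is not vacuous.

HONEST FRAMING (T4-DAG p. 1).  [folklore] composition; flat data = the free field, `E = ℂ`, model level (c5); nothing printed is a hypothesis; no `def`, no `sorry`; axioms standard.
Nothing with background is discharged; V-END with background ∕ NE2 NOT proved; NE3 OPEN; spine PROVED 0∕9 unchanged; rung (B)+1 on a fixed finite T⁴ — NOT infinite volume, NOT
mass gap, NOT Clay.  HONEST DEPENDENCY (cell, verbatim): continuum YM on T⁴ ⇐ BetaPertH ∧ nine spine estimates (0/9 proved); BetaPertH ⇐ (D1) ∧ (D4) ∧ CAP+tail; G-an2-4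
gates asym, D1 and NE2/3/4.
-/

noncomputable section

namespace Summit.QuantumFields.BalabanUV.T4Continuum.VariationalVectorEndMonotoneFlat

open Filter
open scoped Matrix ComplexConjugate ComplexOrder Topology
open Literature.MathematicalPhysics.QuantumFieldTheory.Balaban1983to89.B5Prop11Plancherel (Tor fine Cst Cst_nonneg)
open Literature.Analysis.Complex (qform)
open Summit.QuantumFields.BalabanUV.T4Continuum.VariationalTransfer (blockSpin)
open Summit.QuantumFields.BalabanUV.T4Continuum.VectorBlockTrialForm (nsqV QvL)
open Summit.QuantumFields.BalabanUV.T4Continuum.VariationalVectorForm (ScV lamV lamV_nonneg)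
open Summit.QuantumFields.BalabanUV.T4Continuum.VariationalVectorEffective (unc effV)
open Summit.QuantumFields.BalabanUV.T4Continuum.VariationalVectorTower (QmL)
open Summit.QuantumFields.BalabanUV.T4Continuum.VariationalVectorGaugeSliceB5 (flatR)
open Summit.QuantumFields.BalabanUV.T4Continuum.VariationalVectorGaugeSliceTower
  (Gk Gk' Gmk hGm_flat hG_flat hGtr_flat hRtr_flat hTcomp_flat hPc_tower)
open Summit.QuantumFields.BalabanUV.T4Continuum.VariationalVectorGaugeSliceUB (hUBc_tower)
open Summit.QuantumFields.BalabanUV.T4Continuum.VariationalVectorOneStepPhys (rhoV rhoV_nonneg)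
open Summit.QuantumFields.BalabanUV.T4Continuum.VariationalAssemblySliceMinFlat (hONEm_tower)
open Summit.QuantumFields.BalabanUV.T4Continuum.VariationalVectorRegularityFlat (hREG_flat_closed)
open Summit.QuantumFields.BalabanUV.T4Continuum.CTGaugeTerm (BXp)
open Summit.QuantumFields.BalabanUV.T4Continuum.ScalarAveragedCompression (sigma0)
open Summit.QuantumFields.BalabanUV.T4Continuum.VariationalVectorEndMonotone (effV_tendsto_of_upper_geom)

variable {d : ℕ} (L : ℕ) [NeZero L] (M : Fin d → ℕ) [hM : ∀ μ, NeZero (M μ)]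

/-- **THE MONOTONE END AT FLAT DATA (K-test of (M2)).**  For `1 ≤ d`, `2 ≤ L`, `0 < a` the four displayed leaves of `effV_tendsto_of_upper_geom` are kernel theorems at flat data
(coarse V-UB `hUBc_tower`, coarse V-P `hPc_tower`, (ONE-min) `hONEm_tower` with `ε₁ k = 4(d+26)L∕(L^k)² ≤ 4(d+26)L·(L⁻²)^k`, `δ′ = 0`, V-REG `hREG_flat_closed`), hence the flat
effective 1-form actions along `n_k = L^k` CONVERGE — obtained here WITHOUT the slice law and WITHOUT the Federbush step (and therefore without a rate). [folklore] -/
theorem effV_flat_tendsto_of_upper (hd : 1 ≤ d) (hL : 2 ≤ L) {a : ℝ} (ha : 0 < a) :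
    ∃ Xlim : Matrix (Tor M × Fin d) (Tor M × Fin d) ℂ,
      Tendsto (fun k => effV (L ^ k) M (flatR (L ^ k) M) (Gmk L M k) (QmL (L ^ k) M (fun _ _ _ _ => (1 : ℂ →L[ℂ] ℂ))) a) atTop (𝓝 Xlim) ∧
      Xlim.IsHermitian ∧ (∀ v, 0 ≤ qform Xlim v) ∧
      ∀ φ : Tor M → Fin d → ℂ, Tendsto (fun k => blockSpin (QvL (L ^ k) M (fun _ _ _ _ => (1 : ℂ →L[ℂ] ℂ))) (ScV (L ^ k) M (flatR (L ^ k) M) (Gk L M k)) φ)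
        atTop (𝓝 (qform Xlim (unc φ))) := by
  have hL0 : (0 : ℝ) < L := by exact_mod_cast Nat.pos_of_ne_zero (NeZero.ne L)
  have hL1 : (1 : ℝ) < L := by exact_mod_cast hL
  have hθ0 : (0 : ℝ) ≤ ((L : ℝ)⁻¹) ^ 2 := by positivity
  have hθ1 : ((L : ℝ)⁻¹) ^ 2 < 1 := by
    have h1 : (L : ℝ)⁻¹ < 1 := inv_lt_one_of_one_lt₀ hL1
    have h0 : (0 : ℝ) ≤ (L : ℝ)⁻¹ := by positivity
    nlinarith
  have hΛ0 : 0 ≤ lamV d 0 d 0 := lamV_nonneg (Nat.cast_nonneg d) le_rfl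
  have hCP0 : 0 ≤ ((d : ℝ) + 1) * Cst d 1 := by have := Cst_nonneg d 1; positivity
  have hCR0 : 0 ≤ 8 * lamV d 0 d 0 + 8 * (BXp d 1 ^ 2 * ((sigma0 d 1) ^ 2)⁻¹) ^ 2 * ((d + 1 : ℝ) * Cst d 1) := by
    have := Cst_nonneg d 1; positivity
  -- the V-ONE small parameter decays at rate `(L⁻¹)²`
  have hε : ∀ k : ℕ, 4 * ((d : ℝ) + 26) * ((L : ℝ) / ((L ^ k : ℕ) : ℝ) ^ 2) ≤ (4 * ((d : ℝ) + 26) * L) * (((L : ℝ)⁻¹) ^ 2) ^ k := fun k => by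
    have e : ((L : ℝ) / ((L ^ k : ℕ) : ℝ) ^ 2) = (L : ℝ) * (((L : ℝ)⁻¹) ^ 2) ^ k := by push_cast; ring
    rw [e]
    exact le_of_eq (by ring)
  exact effV_tendsto_of_upper_geom L M (fun k => flatR (L ^ k) M) (fun k => flatR L (fine (L ^ k) M)) (Gmk L M) (Gk L M) (Gk' L M)
    (fun k => fun _ _ _ _ => (1 : ℂ →L[ℂ] ℂ)) (fun k => fun _ _ _ _ => (1 : ℂ →L[ℂ] ℂ))
    (hGm_flat L M) (hG_flat L M) (hTcomp_flat L M) (hRtr_flat L M) (hGtr_flat L M) ha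
    (fun _ => lamV d 0 d 0) (fun _ => ((d : ℝ) + 1) * Cst d 1)
    (fun _ => 8 * lamV d 0 d 0 + 8 * (BXp d 1 ^ 2 * ((sigma0 d 1) ^ 2)⁻¹) ^ 2 * ((d + 1 : ℝ) * Cst d 1))
    (fun k => 4 * ((d : ℝ) + 26) * ((L : ℝ) / ((L ^ k : ℕ) : ℝ) ^ 2)) (fun _ => 0)
    (Λs := lamV d 0 d 0) (CPs := ((d : ℝ) + 1) * Cst d 1)
    (CRs := 8 * lamV d 0 d 0 + 8 * (BXp d 1 ^ 2 * ((sigma0 d 1) ^ 2)⁻¹) ^ 2 * ((d + 1 : ℝ) * Cst d 1))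
    (cε := 4 * ((d : ℝ) + 26) * L) (cδ' := 0) (θ := ((L : ℝ)⁻¹) ^ 2)
    (fun _ => hΛ0) (fun _ => le_rfl) (fun _ => hCP0) (fun _ => le_rfl) (fun _ => hCR0) (fun _ => le_rfl)
    (fun _ => by positivity) (fun _ => le_rfl) hθ0 hθ1 hε (fun _ => by rw [zero_mul])
    (ρV := fun k => rhoV (L ^ k) M (flatR (L ^ k) M)) (fun k W => rhoV_nonneg (L ^ k) M _ W)
    (hUBc_tower L M hd) (hPc_tower L M) (hONEm_tower L M) (fun k => hREG_flat_closed (L ^ k) M hΛ0 (hUBc_tower L M hd k))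

end Summit.QuantumFields.BalabanUV.T4Continuum.VariationalVectorEndMonotoneFlat

end
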